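import Summits.BirchSwinnertonDyer.Rank1Residual.X5.SelmerSolitaireRebase
import Summits.BirchSwinnertonDyer.Rank1Residual.X5.SelmerSolitaireExtendVec
import HarnessLib

/-!
# Selmer solitaire: transport of the BAD₁ decoration under re-basing (R3)

Cell `b2b-bsdres`, O1 (p = 2) PROVER ORDER v2.8 (ii′) (x11b3-p4; item (R3) of
`HOME/b2b-bsdres-x11b3-p4/T4PRIME-PLAN.md`).  Pure 𝔽₂ linear algebra; theorems only (+ one plumbing
definition `decVec`); reach-neutral; nothing booked; O1 OPEN.

Encode a decoration `(A₀, ε₀)` as the vector `c = 𝟙_{A₀} + ε₀ e_∞` (`decVec`).  Then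
`Bad1Consistent P A₀ ε₀ ⟺ (Ŝc + c)|_D = 𝟙_D` and a move with new row `μ` is admissible iff `μ ⬝ c = 1`.
Re-basing at a core `X` (`A = X⁺`, `Ŝ' = Ŝ ∗ A`): the EXCHANGE IMAGE `c' = (Ŝc|_A, c|_{Aᶜ})` is again a
decoration vector, namely that of **`(A₀ ∆ X, ε′)` with `ε′ = ε₀` if `#X` is even and
`ε′ = ∑_{a ∈ A₀} Ŝ(∞, a)` if `#X` is odd** (`decVec_symmDiff`), and since `Ŝ'c' + c' = Ŝc + c` (exchange
relation) consistency transports (`bad1Consistent_pivotPos`); admissibility transports along the row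
transformation `ν = μ𝟙_{Aᶜ} + Ŝ'(μ𝟙_A)` of (R2) because `ν ⬝ c' = μ ⬝ c` (`admissible_transport`).
Numerical evidence preceded the proof: `HOME/b2b-bsdres-x11b3-p4/o1py/rebase_check.py` (s ≤ 4, exhaustive).
This is the pure-graph form of lens-2 G5.9 (0) (`z′(c₀) = 𝟙_{A ∆ X}`; the ε-coordinate is the type(X)
coefficient). [cite: MazurRubin2004, §4.3] [cite: Tsatsomeros2000, Thm. 3.1]
-/

namespace Summit.BirchSwinnertonDyer.Rank1Residual.X5.SelmerSolitaire

open Finset Matrix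

variable {s : ℕ}

/-- The decoration vector `c = 𝟙_{A₀} + ε₀ e_∞` of `(A₀, ε₀)` (plumbing definition). [cite: MazurRubin2004, §4.3] -/
def decVec (A₀ : Finset (Fin s)) (ε₀ : ZMod 2) : V s → ZMod 2
  | none => ε₀
  | some i => if i ∈ A₀ then 1 else 0

/-- `c ∞ = ε₀`. [folklore] -/
@[simp] theorem decVec_none (A₀ : Finset (Fin s)) (ε₀ : ZMod 2) : decVec A₀ ε₀ none = ε₀ := rfl

/-- `c i = [i ∈ A₀]`. [folklore] -/
theorem decVec_some (A₀ : Finset (Fin s)) (ε₀ : ZMod 2) (i : Fin s) :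
    decVec A₀ ε₀ (some i) = if i ∈ A₀ then 1 else 0 := rfl

/-- `(Ŝ c)(v) = ∑_{a ∈ A₀} Ŝ v a + ε₀ Ŝ v ∞`. [folklore] -/
theorem mulVec_decVec (P : Position s) (A₀ : Finset (Fin s)) (ε₀ : ZMod 2) (v : V s) :
    (P.S *ᵥ decVec A₀ ε₀) v = (∑ a ∈ A₀, P.S v (some a)) + ε₀ * P.S v none := by
  classical
  simp only [Matrix.mulVec, dotProduct]
  rw [Fintype.sum_option, decVec_none, mul_comm]
  rw [add_comm]
  congr 1
  rw [← Finset.sum_subset (Finset.subset_univ A₀)]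
  · refine Finset.sum_congr rfl fun a ha => ?_
    rw [decVec_some, if_pos ha, mul_one]
  · intro a _ ha
    rw [decVec_some, if_neg ha, mul_zero]

/-- **Consistency in vector form**: `Bad1Consistent P A₀ ε₀ ⟺ ∀ i, (Ŝc)(i) + c(i) = 1`.
[cite: MazurRubin2004, §4.3] -/
theorem bad1Consistent_iff_decVec (P : Position s) (A₀ : Finset (Fin s)) (ε₀ : ZMod 2) :
    Bad1Consistent P A₀ ε₀ ↔
      ∀ i : Fin s, (P.S *ᵥ decVec A₀ ε₀) (some i) + decVec A₀ ε₀ (some i) = 1 := by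
  unfold Bad1Consistent
  refine forall_congr' fun i => ?_
  rw [mulVec_decVec, decVec_some]
  by_cases hi : i ∈ A₀
  · rw [if_pos hi, if_pos hi]
    constructor
    · intro h; rw [h, zero_add]
    · intro h
      have : (∑ a ∈ A₀, P.S (some i) (some a)) + ε₀ * P.S (some i) none =
          (∑ a ∈ A₀, P.S (some i) (some a)) + ε₀ * P.S (some i) none + 1 + 1 := by
        rw [add_assoc, CharTwo.add_self_eq_zero, add_zero]
      rw [this, h]
      exact CharTwo.add_self_eq_zero _
  · rw [if_neg hi, if_neg hi, add_zero]

/-- **Admissibility in vector form**: the move `extend P μ` is admissible iff `μ ⬝ c = 1`.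
[cite: MazurRubin2004, §4.3] -/
theorem admissibleExtends_extend_iff (P : Position s) (A₀ : Finset (Fin s)) (ε₀ : ZMod 2)
    (μ : V s → ZMod 2) :
    AdmissibleExtends P A₀ ε₀ (extend P μ) ↔ μ ⬝ᵥ decVec A₀ ε₀ = 1 := by
  classical
  unfold AdmissibleExtends
  have h1 : (extend P μ).S (some (Fin.last s)) none = μ none := extend_S_new_oldV P μ none
  have h2 : ∀ a : Fin s, (extend P μ).S (some (Fin.last s)) (some a.castSucc) = μ (some a) :=
    fun a => extend_S_new_oldV P μ (some a)
  simp only [h1, h2]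
  have hdot : μ ⬝ᵥ decVec A₀ ε₀ = μ none * ε₀ + ∑ a ∈ A₀, μ (some a) := by
    simp only [dotProduct]
    rw [Fintype.sum_option, decVec_none]
    congr 1
    rw [← Finset.sum_subset (Finset.subset_univ A₀)]
    · refine Finset.sum_congr rfl fun a ha => ?_
      rw [decVec_some, if_pos ha, mul_one]
    · intro a _ ha
      rw [decVec_some, if_neg ha, mul_zero]
  rw [hdot]
  constructor
  · rintro ⟨-, h⟩; exact h
  · intro h; exact ⟨extend_extends P μ, h⟩

/-- **The exchange image of a decoration vector is a decoration vector**: for `A = X⁺` and a consistent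
`(A₀, ε₀)`, `(Ŝc|_A, c|_{Aᶜ}) = 𝟙_{A₀ ∆ X} + ε′ e_∞` with `ε′ = ε₀` (`#X` even) or `∑_{a∈A₀} Ŝ ∞ a`
(`#X` odd). [cite: MazurRubin2004, §4.3] -/
theorem decVec_symmDiff (P : Position s) (A₀ : Finset (Fin s)) (ε₀ : ZMod 2) (X : Finset (Fin s))
    (hc : Bad1Consistent P A₀ ε₀) :
    (plus X).piecewise (P.S *ᵥ decVec A₀ ε₀) (decVec A₀ ε₀) =
      decVec (symmDiff A₀ X) (if Even X.card then ε₀ else ∑ a ∈ A₀, P.S none (some a)) := by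
  classical
  funext v
  cases v with
  | none =>
    rw [decVec_none]
    by_cases hX : Even X.card
    · rw [if_pos hX, Finset.piecewise_eq_of_notMem _ _ _ (fun h => (none_mem_plus_iff X).mp h hX),
        decVec_none]
    · rw [if_neg hX, Finset.piecewise_eq_of_mem _ _ _ ((none_mem_plus_iff X).mpr hX), mulVec_decVec,
        P.loopless, mul_zero, add_zero]
  | some i =>
    rw [decVec_some]
    by_cases hiX : i ∈ X
    · rw [Finset.piecewise_eq_of_mem _ _ _ ((some_mem_plus_iff X i).mpr hiX)]
      have h := (bad1Consistent_iff_decVec P A₀ ε₀).mp hc i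
      rw [decVec_some] at h
      by_cases hiA : i ∈ A₀
      · rw [if_pos hiA] at h
        have hn : i ∉ symmDiff A₀ X := fun hm => by
          rcases Finset.mem_symmDiff.mp hm with ⟨_, h2⟩ | ⟨_, h2⟩
          · exact h2 hiX
          · exact h2 hiA
        rw [if_neg hn]
        -- `(Ŝc)(i) + 1 = 1 ⟹ (Ŝc)(i) = 0`
        have h' : (P.S *ᵥ decVec A₀ ε₀) (some i) + 1 + 1 = 1 + 1 := by rw [h]
        rw [add_assoc, CharTwo.add_self_eq_zero, add_zero] at h'
        exact h'
      · rw [if_neg hiA, add_zero] at h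
        rw [if_pos (Finset.mem_symmDiff.mpr (Or.inr ⟨hiX, hiA⟩)), h]
    · rw [Finset.piecewise_eq_of_notMem _ _ _ (fun h => hiX ((some_mem_plus_iff X i).mp h)), decVec_some]
      by_cases hiA : i ∈ A₀
      · rw [if_pos hiA, if_pos (Finset.mem_symmDiff.mpr (Or.inl ⟨hiA, hiX⟩))]
      · have hn : i ∉ symmDiff A₀ X := fun hm => by
          rcases Finset.mem_symmDiff.mp hm with ⟨h1, _⟩ | ⟨h1, _⟩
          · exact hiA h1
          · exact hiX h1
        rw [if_neg hiA, if_neg hn]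

/-- **(R3 i) Consistency transports under re-basing**: `(A₀ ∆ X, ε′)` is consistent for the pivot at a
core `X`. [cite: MazurRubin2004, §4.3] -/
theorem bad1Consistent_pivotPos (P : Position s) (A₀ : Finset (Fin s)) (ε₀ : ZMod 2) (X : Finset (Fin s))
    (hX : Core P X) (hc : Bad1Consistent P A₀ ε₀) :
    Bad1Consistent (pivotPos P X hX) (symmDiff A₀ X)
      (if Even X.card then ε₀ else ∑ a ∈ A₀, P.S none (some a)) := by
  classical
  rw [bad1Consistent_iff_decVec, ← decVec_symmDiff P A₀ ε₀ X hc, pivotPos_S,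
    pivot_mulVec_piecewise (isUnit_det_of_core P X hX)]
  intro i
  have h := (bad1Consistent_iff_decVec P A₀ ε₀).mp hc i
  by_cases hi : (some i : V s) ∈ plus X
  · rw [Finset.piecewise_eq_of_mem _ _ _ hi, Finset.piecewise_eq_of_mem _ _ _ hi, add_comm]; exact h
  · rw [Finset.piecewise_eq_of_notMem _ _ _ hi, Finset.piecewise_eq_of_notMem _ _ _ hi]; exact h

/-- **(R3 ii) Admissibility transports under re-basing** along the row transformation of (R2),
`ν = μ𝟙_{Aᶜ} + Ŝ'(μ𝟙_A)`: `ν ⬝ c′ = μ ⬝ c`. [cite: MazurRubin2004, §4.3] -/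
theorem admissible_transport (P : Position s) (A₀ : Finset (Fin s)) (ε₀ : ZMod 2) (X : Finset (Fin s))
    (hX : Core P X) (hc : Bad1Consistent P A₀ ε₀) (μ : V s → ZMod 2) :
    AdmissibleExtends P A₀ ε₀ (extend P μ) ↔
      AdmissibleExtends (pivotPos P X hX) (symmDiff A₀ X)
        (if Even X.card then ε₀ else ∑ a ∈ A₀, P.S none (some a))
        (extend (pivotPos P X hX)
          (fun v => (plus X).piecewise 0 μ v + (pivot P.S (plus X) *ᵥ (plus X).piecewise μ 0) v)) := by
  classical
  rw [admissibleExtends_extend_iff, admissibleExtends_extend_iff, ← decVec_symmDiff P A₀ ε₀ X hc]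
  set A := plus X with hA
  set c := decVec A₀ ε₀ with hcdef
  set w : V s → ZMod 2 := A.piecewise μ 0 with hw
  have hAu : IsUnit (P.S.submatrix (Subtype.val : ↥A → V s) Subtype.val).det := isUnit_det_of_core P X hX
  have hQsymm : (pivot P.S A).IsSymm := pivot_isSymm P A
  -- `ν ⬝ c' = (μ𝟙_{Aᶜ}) ⬝ c' + w ⬝ (Ŝ' c')` and `Ŝ' c' = (c|_A, Ŝc|_{Aᶜ})`
  have hexch : pivot P.S A *ᵥ A.piecewise (P.S *ᵥ c) c = A.piecewise c (P.S *ᵥ c) :=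
    pivot_mulVec_piecewise hAu c
  have h1 : (fun v => (pivot P.S A *ᵥ w) v) ⬝ᵥ A.piecewise (P.S *ᵥ c) c =
      w ⬝ᵥ A.piecewise c (P.S *ᵥ c) := by
    rw [← hexch, Matrix.dotProduct_mulVec, ← Matrix.mulVec_transpose, hQsymm.eq, dotProduct_comm]
  have key : (fun v => A.piecewise 0 μ v + (pivot P.S A *ᵥ w) v) ⬝ᵥ A.piecewise (P.S *ᵥ c) c = μ ⬝ᵥ c := by
    have e : (fun v => A.piecewise 0 μ v + (pivot P.S A *ᵥ w) v) =
        A.piecewise 0 μ + fun v => (pivot P.S A *ᵥ w) v := by funext v; rfl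
    rw [e, add_dotProduct, h1]
    simp only [dotProduct, ← Finset.sum_add_distrib]
    refine Finset.sum_congr rfl fun v _ => ?_
    by_cases hv : v ∈ A
    · simp [hw, Finset.piecewise_eq_of_mem _ _ _ hv]
    · simp [hw, Finset.piecewise_eq_of_notMem _ _ _ hv]
  rw [key]

end Summit.BirchSwinnertonDyer.Rank1Residual.X5.SelmerSolitaire
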